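import Summits.CriticalPhenomena.PercolationContinuityZ3.Theorems.Transplant.FKConnectivityAllQPat3SymCone
import HarnessLib

/-!
# Connectivity correlation inequalities for `φ_{w,q}`, every `q > 0` — a FAST executable product-cone certificate check
# (Stage S2, part 2c): support filtering, unrolled tensors, pairwise kernel evaluation

Definitions + theorems file (`--supports stmt-CriticalPhenomena-4575`), census lane `prim-bschramm-census` (gen 36) of the post-continuity programme (LANE 2 bschramm, FK sub-lane);
builds on p205010 (kernel theorem, internal audit signed; external expert review pending).
No named facts, no sorries; standard axioms.  MEASURED (census g36 memo §10): `FK.certCheck3` with an EMPTY product list costs ≈ 60 s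
by `decide +kernel` (plain `decide` exceeds the default heartbeats), and a 111-product list in ONE declaration exceeds the kernel's
memory bound; the check of this file, split into 25 declarations (one per pattern pair of the first piece, `FK.certCheck3_of_pairs`),
verified a synthetic 111-product certificate of census shape (T_sym-type first generators, STAR-type / entry generators) in ≈ 150 s
of kernel time in total, standard axioms.
* `FK.suppAt g P Q` — some level of the two-level generator `g` is nonzero at `(P, Q)`;
* `FK.Prod3.tensorF` / `FK.Prod3.tensorF_eq`, `FK.target3F` / `FK.target3F_eq` — unrolled two-level tensor and target;
* `FK.cellLoopG`, `FK.loop2G`, `FK.rowG` / `FK.loop1G_of_rows`, `FK.loop1G`, **`FK.certCheckGF`** — the level loop innermost (cell data precomputed), the products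
  filtered by the supports of `g_2`, `g_1`, `g_K` on the way in;
* `FK.sum_map_filter_of_zero`, `FK.Prod3.tensor_eq_zero_K/_1/_2` — filtered-out products contribute zero;
* **`FK.certCheck3_of_fast`** (`certCheck3F = true → certCheck3 = true`) and **`FK.certCheck3_of_pairs`** (shift bound + the 25
  first-pair loops `FK.loop1 … PK QK = true`, each provable by its own `decide +kernel`, ⇒ `certCheck3 = true`), so that
  `FK.theta_level_nonneg_of_cert` / `FK.ring_level_nonneg_of_cert` (file `…Pat3GraphCone.lean`) apply verbatim.
RECIPE for a data file: `def prods : List Prod3 := […]`; 25 theorems `pair_P_Q : loop1 join3 corr3 T D B (prods.filter fun p =>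
suppAt p.gK Pat3.P Pat3.Q) Pat3.P Pat3.Q = true := by decide +kernel`; then `certCheck3_of_pairs (by decide) fun PK QK => by
cases PK <;> cases QK; exacts [pair_all_all, …]`.
[cite: AyyerLinussonRavichandran2025, §7 eq. (13)–(15) (p. 22)] [cite: Grimmett2006, §3.8 (pp. 61–62)]
-/

noncomputable section

namespace Summit.CriticalPhenomena.PercolationContinuityZ3.Theorems

namespace FK

open SimpleGraph Literature.Probability.LatticeModels Literature.Probability.Percolation




/-! ### Support filtering and unrolled evaluation (census g36) -/

section FastCheck

/-- Support test of a two-level generator at a pattern pair: some level is nonzero. [folklore] -/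
def suppAt (g : ℕ → Pat3 → Pat3 → ℤ) (P Q : Pat3) : Bool :=
  !(decide (g 0 P Q = 0) && decide (g 1 P Q = 0))

/-- Unrolled product tensor: the eight `(c_K, c_1, c_2) ∈ {0,1}³` terms of `FK.Prod3.tensor`. [folklore] -/
def Prod3.tensorF (p : Prod3) (d : ℕ) (PK QK P1 Q1 P2 Q2 : Pat3) : ℤ :=
  (if p.shift = d then p.gK 0 PK QK * p.g1 0 P1 Q1 * p.g2 0 P2 Q2 else 0) +
  (if 1 + p.shift = d then p.gK 0 PK QK * p.g1 0 P1 Q1 * p.g2 1 P2 Q2 else 0) +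
  ((if 1 + p.shift = d then p.gK 0 PK QK * p.g1 1 P1 Q1 * p.g2 0 P2 Q2 else 0) +
  (if 2 + p.shift = d then p.gK 0 PK QK * p.g1 1 P1 Q1 * p.g2 1 P2 Q2 else 0)) +
  ((if 1 + p.shift = d then p.gK 1 PK QK * p.g1 0 P1 Q1 * p.g2 0 P2 Q2 else 0) +
  (if 2 + p.shift = d then p.gK 1 PK QK * p.g1 0 P1 Q1 * p.g2 1 P2 Q2 else 0) +
  ((if 2 + p.shift = d then p.gK 1 PK QK * p.g1 1 P1 Q1 * p.g2 0 P2 Q2 else 0) +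
  (if 3 + p.shift = d then p.gK 1 PK QK * p.g1 1 P1 Q1 * p.g2 1 P2 Q2 else 0)))

/-- The unrolled tensor agrees with `FK.Prod3.tensor`. [folklore] -/
theorem Prod3.tensorF_eq (p : Prod3) (d : ℕ) (PK QK P1 Q1 P2 Q2 : Pat3) :
    p.tensorF d PK QK P1 Q1 P2 Q2 = p.tensor d PK QK P1 Q1 P2 Q2 := by
  simp only [Prod3.tensor, Prod3.tensorF, Finset.sum_range_succ, Finset.sum_range_zero, zero_add, add_zero, Nat.reduceAdd]

/-- Unrolled target tensor (the two levels of `FK.target3`), from the cell's precomputed correction `cr` and the two target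
values `T0, T1` at the joined pattern pair. [folklore] -/
def target3F (cr : ℕ) (T0 T1 : ℤ) (d : ℕ) : ℤ :=
  (if cr = d then T0 else 0) + (if cr + 1 = d then T1 else 0)

/-- The unrolled target agrees with `FK.target3`. [folklore] -/
theorem target3F_eq (join : Pat3 → Pat3 → Pat3 → Pat3) (corr : Pat3 → Pat3 → Pat3 → ℕ) (T : ℕ → Pat3 → Pat3 → ℤ) (d : ℕ)
    (PK QK P1 Q1 P2 Q2 : Pat3) :
    target3F (corr PK P1 P2 + corr QK Q1 Q2) (T 0 (join PK P1 P2) (join QK Q1 Q2)) (T 1 (join PK P1 P2) (join QK Q1 Q2)) d =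
      target3 join corr T d PK QK P1 Q1 P2 Q2 := by
  simp only [target3, target3F, Finset.sum_range_succ, Finset.sum_range_zero, zero_add, add_zero]

/-- Unrolled symmetrised target (`FK.target3Sym` from eight unrolled `FK.target3F`). [folklore] -/
def target3SymF (join : Pat3 → Pat3 → Pat3 → Pat3) (corr : Pat3 → Pat3 → Pat3 → ℕ) (T : ℕ → Pat3 → Pat3 → ℤ) (d : ℕ)
    (PK QK P1 Q1 P2 Q2 : Pat3) : ℤ :=
  target3F (corr PK P1 P2 + corr QK Q1 Q2) (T 0 (join PK P1 P2) (join QK Q1 Q2)) (T 1 (join PK P1 P2) (join QK Q1 Q2)) d +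
    target3F (corr QK P1 P2 + corr PK Q1 Q2) (T 0 (join QK P1 P2) (join PK Q1 Q2)) (T 1 (join QK P1 P2) (join PK Q1 Q2)) d +
    (target3F (corr PK Q1 P2 + corr QK P1 Q2) (T 0 (join PK Q1 P2) (join QK P1 Q2)) (T 1 (join PK Q1 P2) (join QK P1 Q2)) d +
      target3F (corr QK Q1 P2 + corr PK P1 Q2) (T 0 (join QK Q1 P2) (join PK P1 Q2)) (T 1 (join QK Q1 P2) (join PK P1 Q2)) d) +
  (target3F (corr PK P1 Q2 + corr QK Q1 P2) (T 0 (join PK P1 Q2) (join QK Q1 P2)) (T 1 (join PK P1 Q2) (join QK Q1 P2)) d +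
    target3F (corr QK P1 Q2 + corr PK Q1 P2) (T 0 (join QK P1 Q2) (join PK Q1 P2)) (T 1 (join QK P1 Q2) (join PK Q1 P2)) d +
    (target3F (corr PK Q1 Q2 + corr QK P1 P2) (T 0 (join PK Q1 Q2) (join QK P1 P2)) (T 1 (join PK Q1 Q2) (join QK P1 P2)) d +
      target3F (corr QK Q1 Q2 + corr PK P1 P2) (T 0 (join QK Q1 Q2) (join PK P1 P2)) (T 1 (join QK Q1 Q2) (join PK P1 P2)) d))

/-- The unrolled symmetrised target agrees with `FK.target3Sym`. [folklore] -/
theorem target3SymF_eq (join : Pat3 → Pat3 → Pat3 → Pat3) (corr : Pat3 → Pat3 → Pat3 → ℕ) (T : ℕ → Pat3 → Pat3 → ℤ) (d : ℕ)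
    (PK QK P1 Q1 P2 Q2 : Pat3) :
    target3SymF join corr T d PK QK P1 Q1 P2 Q2 = target3Sym join corr T d PK QK P1 Q1 P2 Q2 := by
  simp only [target3SymF, target3Sym, target3F_eq]

/-- Level loop at one cell, generic target: `m · Σ_j lam_j π_j(d; cell) ≤ D · τ(d; cell)` for all `d < B + 6`, over the
(pre-filtered) products; `τc` is the cell's target as a function of the level offset. [folklore] -/
def cellLoopG (m D B : ℕ) (τc : ℕ → ℤ) (prods2 : List Prod3) (PK QK P1 Q1 P2 Q2 : Pat3) : Bool :=
  (List.range (B + 6)).all fun d =>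
    decide ((m : ℤ) * ((prods2.map fun p => (p.lam : ℤ) * p.tensorF d PK QK P1 Q1 P2 Q2).sum) ≤ (D : ℤ) * τc d)

/-- Loop over the third piece's pattern pair, filtering the products by the third generator's support. [folklore] -/
def loop2G (τ : ℕ → Pat3 → Pat3 → Pat3 → Pat3 → Pat3 → Pat3 → ℤ) (m D B : ℕ) (prods1 : List Prod3) (PK QK P1 Q1 : Pat3) :
    Bool :=
  Pat3.list.all fun P2 => Pat3.list.all fun Q2 =>
    cellLoopG m D B (fun d => τ d PK QK P1 Q1 P2 Q2) (prods1.filter fun p => suppAt p.g2 P2 Q2) PK QK P1 Q1 P2 Q2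

/-- Loop over the second piece's pattern pair, filtering the products by the second generator's support. [folklore] -/
def loop1G (τ : ℕ → Pat3 → Pat3 → Pat3 → Pat3 → Pat3 → Pat3 → ℤ) (m D B : ℕ) (prodsK : List Prod3) (PK QK : Pat3) : Bool :=
  Pat3.list.all fun P1 => Pat3.list.all fun Q1 =>
    loop2G τ m D B (prodsK.filter fun p => suppAt p.g1 P1 Q1) PK QK P1 Q1

/-- One ROW of the first-pair loop: fixed `(P_K, Q_K, P_1)`, all `Q_1` (the unit of kernel evaluation in the data files —
small enough for the smaller farm nodes' memory bound). [folklore] -/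
def rowG (τ : ℕ → Pat3 → Pat3 → Pat3 → Pat3 → Pat3 → Pat3 → ℤ) (m D B : ℕ) (prodsK : List Prod3) (PK QK P1 : Pat3) : Bool :=
  Pat3.list.all fun Q1 => loop2G τ m D B (prodsK.filter fun p => suppAt p.g1 P1 Q1) PK QK P1 Q1

/-- The first-pair loop from its five rows. [folklore] -/
theorem loop1G_of_rows {τ : ℕ → Pat3 → Pat3 → Pat3 → Pat3 → Pat3 → Pat3 → ℤ} {m D B : ℕ} {prodsK : List Prod3} {PK QK : Pat3}
    (h : ∀ P1 : Pat3, rowG τ m D B prodsK PK QK P1 = true) : loop1G τ m D B prodsK PK QK = true := by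
  unfold loop1G
  simp only [List.all_eq_true]
  intro P1 _ Q1 hQ1
  have h1 := h P1
  unfold rowG at h1
  simp only [List.all_eq_true] at h1
  exact h1 Q1 hQ1

/-- **Fast executable product-cone certificate check, generic target** `τ` **and multiplier** `m` (for `FK.cone3_level_nonneg`:
`τ = FK.target3F…`, `m = 1`; for `FK.cone3_level_nonneg_sym`: `τ = FK.target3SymF join corr T`, `m = 8`). [folklore] -/
def certCheckGF (τ : ℕ → Pat3 → Pat3 → Pat3 → Pat3 → Pat3 → Pat3 → ℤ) (m D B : ℕ) (prods : List Prod3) : Bool :=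
  (prods.all fun p => decide (p.shift ≤ B)) &&
    Pat3.list.all fun PK => Pat3.list.all fun QK =>
      loop1G τ m D B (prods.filter fun p => suppAt p.gK PK QK) PK QK

/-- A failed support test means both levels vanish. [folklore] -/
theorem suppAt_false {g : ℕ → Pat3 → Pat3 → ℤ} {P Q : Pat3} (h : suppAt g P Q = false) : g 0 P Q = 0 ∧ g 1 P Q = 0 := by
  unfold suppAt at h
  cases h0 : decide (g 0 P Q = 0) <;> cases h1 : decide (g 1 P Q = 0) <;> simp_all

/-- A product whose first generator vanishes at `(P_K, Q_K)` has no tensor entries over that pair. [folklore] -/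
theorem Prod3.tensor_eq_zero_K (p : Prod3) {PK QK : Pat3} (h : p.gK 0 PK QK = 0 ∧ p.gK 1 PK QK = 0) (d : ℕ)
    (P1 Q1 P2 Q2 : Pat3) : p.tensor d PK QK P1 Q1 P2 Q2 = 0 := by
  unfold Prod3.tensor
  refine Finset.sum_eq_zero fun cK hcK => Finset.sum_eq_zero fun c1 _ => Finset.sum_eq_zero fun c2 _ => ?_
  rw [Finset.mem_range] at hcK
  have hz : p.gK cK PK QK = 0 := by interval_cases cK <;> [exact h.1; exact h.2]
  simp [hz]

/-- A product whose second generator vanishes at `(P_1, Q_1)` has no tensor entries over that pair. [folklore] -/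
theorem Prod3.tensor_eq_zero_1 (p : Prod3) {P1 Q1 : Pat3} (h : p.g1 0 P1 Q1 = 0 ∧ p.g1 1 P1 Q1 = 0) (d : ℕ)
    (PK QK P2 Q2 : Pat3) : p.tensor d PK QK P1 Q1 P2 Q2 = 0 := by
  unfold Prod3.tensor
  refine Finset.sum_eq_zero fun cK _ => Finset.sum_eq_zero fun c1 hc1 => Finset.sum_eq_zero fun c2 _ => ?_
  rw [Finset.mem_range] at hc1
  have hz : p.g1 c1 P1 Q1 = 0 := by interval_cases c1 <;> [exact h.1; exact h.2]
  simp [hz]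

/-- A product whose third generator vanishes at `(P_2, Q_2)` has no tensor entries over that pair. [folklore] -/
theorem Prod3.tensor_eq_zero_2 (p : Prod3) {P2 Q2 : Pat3} (h : p.g2 0 P2 Q2 = 0 ∧ p.g2 1 P2 Q2 = 0) (d : ℕ)
    (PK QK P1 Q1 : Pat3) : p.tensor d PK QK P1 Q1 P2 Q2 = 0 := by
  unfold Prod3.tensor
  refine Finset.sum_eq_zero fun cK _ => Finset.sum_eq_zero fun c1 _ => Finset.sum_eq_zero fun c2 hc2 => ?_
  rw [Finset.mem_range] at hc2
  have hz : p.g2 c2 P2 Q2 = 0 := by interval_cases c2 <;> [exact h.1; exact h.2]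
  simp [hz]

/-- Dropping products that contribute zero does not change the weighted sum. [folklore] -/
theorem sum_map_filter_of_zero {l : List Prod3} {q : Prod3 → Bool} {f : Prod3 → ℤ}
    (h : ∀ p ∈ l, q p = false → f p = 0) : ((l.filter q).map f).sum = (l.map f).sum := by
  induction l with
  | nil => rfl
  | cons a l ih =>
    have ih' := ih fun p hp => h p (List.mem_cons_of_mem a hp)
    rw [List.filter_cons, List.map_cons, List.sum_cons]
    cases hq : q a
    · rw [h a List.mem_cons_self hq, zero_add]
      simpa using ih'
    · simpa using ih'

/-- **What the 25 first-pair loops say** (the form in which a data file establishes a certificate: each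
`FK.loop1G … PK QK = true` by its own `decide +kernel`): with the shift bound and a target vanishing (or nonnegative) beyond
level offset `B + 6`, the entrywise domination `m · Σ_j lam_j π_j ≤ D · τ` at EVERY level offset and cell. [folklore] -/
theorem certCheckG_of_pairs {τ : ℕ → Pat3 → Pat3 → Pat3 → Pat3 → Pat3 → Pat3 → ℤ} (m D B : ℕ) {prods : List Prod3}
    (hshift : (prods.all fun p => decide (p.shift ≤ B)) = true)
    (hpairs : ∀ PK QK : Pat3, loop1G τ m D B (prods.filter fun p => suppAt p.gK PK QK) PK QK = true)
    (hτ : ∀ d, B + 6 ≤ d → ∀ PK QK P1 Q1 P2 Q2 : Pat3, 0 ≤ τ d PK QK P1 Q1 P2 Q2) (d : ℕ) (PK QK P1 Q1 P2 Q2 : Pat3) :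
    (m : ℤ) * (prods.map fun p => (p.lam : ℤ) * p.tensor d PK QK P1 Q1 P2 Q2).sum ≤ D * τ d PK QK P1 Q1 P2 Q2 := by
  simp only [List.all_eq_true, decide_eq_true_eq] at hshift
  by_cases hd : d < B + 6
  · have h1 := hpairs PK QK
    unfold loop1G at h1
    simp only [List.all_eq_true] at h1
    have h2 := h1 P1 P1.mem_list Q1 Q1.mem_list
    unfold loop2G at h2
    simp only [List.all_eq_true] at h2
    have h3 := h2 P2 P2.mem_list Q2 Q2.mem_list
    unfold cellLoopG at h3
    simp only [List.all_eq_true, decide_eq_true_eq] at h3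
    have h4 := h3 d (List.mem_range.2 hd)
    simp only [Prod3.tensorF_eq] at h4
    rw [sum_map_filter_of_zero (fun p _ hq => by rw [p.tensor_eq_zero_2 (suppAt_false hq), mul_zero]),
      sum_map_filter_of_zero (fun p _ hq => by rw [p.tensor_eq_zero_1 (suppAt_false hq), mul_zero]),
      sum_map_filter_of_zero (fun p _ hq => by rw [p.tensor_eq_zero_K (suppAt_false hq), mul_zero])] at h4
    exact h4
  · rw [not_lt] at hd
    have hz : (prods.map fun p => (p.lam : ℤ) * p.tensor d PK QK P1 Q1 P2 Q2).sum = 0 := by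
      refine List.sum_eq_zero fun x hx => ?_
      rw [List.mem_map] at hx
      obtain ⟨p, hp, rfl⟩ := hx
      rw [Prod3.tensor_eq_zero_of_le p (hshift p hp) hd, mul_zero]
    rw [hz, mul_zero]
    exact mul_nonneg (Nat.cast_nonneg _) (hτ d hd PK QK P1 Q1 P2 Q2)

/-- A passed generic fast check gives the same entrywise domination. [folklore] -/
theorem certCheckGF_spec {τ : ℕ → Pat3 → Pat3 → Pat3 → Pat3 → Pat3 → Pat3 → ℤ} {m D B : ℕ} {prods : List Prod3}
    (h : certCheckGF τ m D B prods = true)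
    (hτ : ∀ d, B + 6 ≤ d → ∀ PK QK P1 Q1 P2 Q2 : Pat3, 0 ≤ τ d PK QK P1 Q1 P2 Q2) (d : ℕ) (PK QK P1 Q1 P2 Q2 : Pat3) :
    (m : ℤ) * (prods.map fun p => (p.lam : ℤ) * p.tensor d PK QK P1 Q1 P2 Q2).sum ≤ D * τ d PK QK P1 Q1 P2 Q2 := by
  unfold certCheckGF at h
  rw [Bool.and_eq_true] at h
  obtain ⟨hshift, hmain⟩ := h
  simp only [List.all_eq_true] at hmain
  exact certCheckG_of_pairs m D B hshift (fun PK QK => hmain PK PK.mem_list QK QK.mem_list) hτ d PK QK P1 Q1 P2 Q2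

/-- **Certificate family for the SYMMETRISED cone lemma from the 25 pair facts** (`τ = FK.target3SymF join corr T`, `m = 8`;
corrections `≤ 2`): exactly the hypothesis `hcert` of `FK.cone3_level_nonneg_sym` for the list's products. [folklore] -/
theorem symCert_of_pairs {join : Pat3 → Pat3 → Pat3 → Pat3} {corr : Pat3 → Pat3 → Pat3 → ℕ} (hcorr : ∀ P1 P2 P3, corr P1 P2 P3 ≤ 2)
    {T : ℕ → Pat3 → Pat3 → ℤ} (D B : ℕ) {prods : List Prod3} (hshift : (prods.all fun p => decide (p.shift ≤ B)) = true)
    (hpairs : ∀ PK QK : Pat3,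
      loop1G (target3SymF join corr T) 8 D B (prods.filter fun p => suppAt p.gK PK QK) PK QK = true)
    (d : ℕ) (PK QK P1 Q1 P2 Q2 : Pat3) :
    8 * ∑ j : Fin prods.length, ((prods.get j).lam : ℤ) * (prods.get j).tensor d PK QK P1 Q1 P2 Q2 ≤
      D * target3Sym join corr T d PK QK P1 Q1 P2 Q2 := by
  rw [← list_sum_eq_finset_sum prods (fun p => (p.lam : ℤ) * p.tensor d PK QK P1 Q1 P2 Q2), ← target3SymF_eq]
  exact_mod_cast certCheckG_of_pairs 8 D B hshift hpairs
    (fun d' hd' PK' QK' P1' Q1' P2' Q2' => by rw [target3SymF_eq, target3Sym_eq_zero_of_le hcorr T hd']) d PK QK P1 Q1 P2 Q2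

/-- **Certificate family for the plain cone lemma from the 25 pair facts** (`τ = FK.target3` unrolled, `m = 1`). [folklore] -/
theorem cert_of_pairs {join : Pat3 → Pat3 → Pat3 → Pat3} {corr : Pat3 → Pat3 → Pat3 → ℕ} (hcorr : ∀ P1 P2 P3, corr P1 P2 P3 ≤ 2)
    {T : ℕ → Pat3 → Pat3 → ℤ} (D B : ℕ) {prods : List Prod3} (hshift : (prods.all fun p => decide (p.shift ≤ B)) = true)
    (hpairs : ∀ PK QK : Pat3,
      loop1G (fun d PK QK P1 Q1 P2 Q2 => target3F (corr PK P1 P2 + corr QK Q1 Q2) (T 0 (join PK P1 P2) (join QK Q1 Q2))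
        (T 1 (join PK P1 P2) (join QK Q1 Q2)) d) 1 D B (prods.filter fun p => suppAt p.gK PK QK) PK QK = true)
    (d : ℕ) (PK QK P1 Q1 P2 Q2 : Pat3) :
    ∑ j : Fin prods.length, ((prods.get j).lam : ℤ) * (prods.get j).tensor d PK QK P1 Q1 P2 Q2 ≤
      D * target3 join corr T d PK QK P1 Q1 P2 Q2 := by
  rw [← list_sum_eq_finset_sum prods (fun p => (p.lam : ℤ) * p.tensor d PK QK P1 Q1 P2 Q2), ← target3F_eq]
  have h := certCheckG_of_pairs 1 D B hshift hpairs
    (fun d' hd' PK' QK' P1' Q1' P2' Q2' => by simp only [target3F_eq, target3_eq_zero_of_le hcorr T hd', le_refl]) d PK QK P1 Q1 P2 Q2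
  simpa using h

end FastCheck

end FK

end Summit.CriticalPhenomena.PercolationContinuityZ3.Theorems

end
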